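import Summits.Ventures.PercRepro.C026C028Recursion
import Summits.Ventures.PercRepro.C026ProbeTransfer

/-!
# C-028(c) through a pendant edge (p6, gen 15; the pendant case of mine-3's step (A))

If the fractional edge `e` joins a vertex `x` to a vertex `y ∉ {a, b, c}` all of whose other edges are
surely closed (`y` is pendant at `e`), then on positive-weight configurations the connections among
`a, b, c` do not depend on `e`: every row of `p[e:=1]` equals the row of `p[e:=0]` and `I_A = 0`, so
C-028(c) at `p[e:=0]` gives C-028(c) at `p` (`C028At_of_pendant`).  This is the one case of step (A)
(`C028StepSure`) that is pure bookkeeping; with the marks' isolation it is also a base of the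
forest-class decomposition.
-/

namespace PercRepro

namespace MultiGraph

variable {V E : Type*} (G : MultiGraph V E) [Fintype E] [DecidableEq E]

omit [Fintype E] [DecidableEq E] in
/-- A vertex all of whose edges are closed is isolated: it is joined only to itself. -/
theorem eq_of_conn_of_closed_at {ω : Config E} {y : V}
    (hclosed : ∀ e', (G.fst e' = y ∨ G.snd e' = y) → ω e' = false) {v : V} (h : G.Conn ω y v) :
    v = y := by
  refine Conn.induction (motive := fun v => v = y) rfl ?_ h
  intro u w _ hadj hu
  obtain ⟨e', he', hends⟩ := hadj
  subst hu
  have : ω e' = false := by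
    rcases hends with ⟨h1, _⟩ | ⟨_, h2⟩
    · exact hclosed e' (Or.inl h1)
    · exact hclosed e' (Or.inr h2)
  rw [he'] at this
  exact absurd this (by decide)

/-- With `e` joining `x` and `y`, all other edges at `y` surely closed, the connections among vertices
other than `y` do not see `e` (on positive-weight configurations). -/
theorem conn_update_true_iff_of_pendant {p : E → ℝ} {e : E} {y : V}
    (hy : G.fst e = y ∨ G.snd e = y)
    (hpend : ∀ e', e' ≠ e → (G.fst e' = y ∨ G.snd e' = y) → p e' = 0)
    {ω : Config E} (hω : 0 < weight p ω) {u v : V} (hu : u ≠ y) (hv : v ≠ y) :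
    G.Conn (Function.update ω e true) u v ↔ G.Conn (Function.update ω e false) u v := by
  have hidem : Function.update ω e true =
      Function.update (Function.update ω e false) e true := by
    rw [Function.update_idem]
  rw [hidem, conn_update_true_iff]
  -- in `ω₀ = ω[e:=false]` the vertex `y` is isolated
  have hiso : ∀ e', (G.fst e' = y ∨ G.snd e' = y) → Function.update ω e false e' = false := by
    intro e' he'
    by_cases h : e' = e
    · subst h; simp
    · rw [Function.update_of_ne h]
      exact eq_false_of_weight_pos hω (hpend e' h he')
  constructor
  · rintro (h | ⟨h1, h2⟩ | ⟨h1, h2⟩)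
    · exact h
    · rcases hy with hy | hy
      · rw [hy] at h1
        exact absurd (G.eq_of_conn_of_closed_at hiso h1.symm) hu
      · rw [hy] at h2
        exact absurd (G.eq_of_conn_of_closed_at hiso h2) hv
    · rcases hy with hy | hy
      · rw [hy] at h2
        exact absurd (G.eq_of_conn_of_closed_at hiso h2) hv
      · rw [hy] at h1
        exact absurd (G.eq_of_conn_of_closed_at hiso h1.symm) hu
  · intro h
    exact Or.inl h

/-- Every row of `p[e:=1]` equals the row of `p[e:=0]` at a pendant edge. -/
theorem law3_update_one_eq_update_zero_of_pendant {p : E → ℝ} (hp : IsProb p) {e : E} {y : V}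
    (hy : G.fst e = y ∨ G.snd e = y)
    (hpend : ∀ e', e' ≠ e → (G.fst e' = y ∨ G.snd e' = y) → p e' = 0) {a b c : V}
    (ha : a ≠ y) (hb : b ≠ y) (hc : c ≠ y) (s : Fin 5) :
    G.law3 (Function.update p e 1) a b c s = G.law3 (Function.update p e 0) a b c s := by
  unfold law3
  rw [prob_update_one_eq_prob_lift, prob_update_zero_eq_prob_lift]
  refine prob_eq_of_eqOn_pos hp fun ω hω => ?_
  simp only [mem_lift, G.mem_partitionEvent_three a b c,
    G.conn_update_true_iff_of_pendant hy hpend hω ha hb,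
    G.conn_update_true_iff_of_pendant hy hpend hω ha hc,
    G.conn_update_true_iff_of_pendant hy hpend hω hb hc]

/-- `I_A = 0` at a pendant edge. -/
theorem pivA26_eq_zero_of_pendant {p : E → ℝ} (hp : IsProb p) {e : E} {y : V}
    (hy : G.fst e = y ∨ G.snd e = y)
    (hpend : ∀ e', e' ≠ e → (G.fst e' = y ∨ G.snd e' = y) → p e' = 0) {a b : V}
    (ha : a ≠ y) (hb : b ≠ y) (c : V) : G.pivA26 p e a b c = 0 := by
  rw [pivA26_eq, prob_update_one_eq_prob_lift, prob_update_zero_eq_prob_lift]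
  rw [prob_eq_of_eqOn_pos hp (Y := lift e false (G.connEvent a b)) ?_, sub_self]
  intro ω hω
  simp only [mem_lift, mem_connEvent, G.conn_update_true_iff_of_pendant hy hpend hω ha hb]

/-- **C-028(c) through a pendant edge**: C-028(c) at `p[e:=0]` gives C-028(c) at `p`. -/
theorem C028At_of_pendant {p : E → ℝ} (hp : IsProb p) {e : E} {y : V}
    (hy : G.fst e = y ∨ G.snd e = y)
    (hpend : ∀ e', e' ≠ e → (G.fst e' = y ∨ G.snd e' = y) → p e' = 0) {a b c : V}
    (ha : a ≠ y) (hb : b ≠ y) (hc : c ≠ y)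
    (h0 : G.C028At (Function.update p e 0) a b c) : G.C028At p a b c := by
  have hrow := G.law3_update_one_eq_update_zero_of_pendant hp hy hpend ha hb hc
  have hd1 : G.c028Cov (Function.update p e 1) a b c = G.c028Cov (Function.update p e 0) a b c := by
    unfold c028Cov
    rw [hrow 0, hrow 1, hrow 2, hrow 3]
  have hd : G.c028Cov p a b c = G.c028Cov (Function.update p e 0) a b c := by
    rw [G.c028Cov_rec p e a b c, hd1, G.pivA26_eq_zero_of_pendant hp hy hpend ha hb c]
    ring
  have h2 : G.law3 p a b c 2 = G.law3 (Function.update p e 0) a b c 2 := by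
    rw [G.law3_split_edge p e a b c 2, hrow 2]
    ring
  have h3 : G.law3 p a b c 3 = G.law3 (Function.update p e 0) a b c 3 := by
    rw [G.law3_split_edge p e a b c 3, hrow 3]
    ring
  unfold C028At at h0 ⊢
  rw [hd, h2, h3]
  exact h0

/-! ### Transfer of the probe inside its sure cluster -/

/-- Every row at the probe `c` equals the row at a probe `v` surely joined to `c`. -/
theorem law3_eq_of_sureConn_probe {p : E → ℝ} (hp : IsProb p) {c v : V} (h : G.SureConn p c v)
    (a b : V) (s : Fin 5) : G.law3 p a b c s = G.law3 p a b v s := by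
  unfold law3
  refine prob_eq_of_eqOn_pos hp fun ω hω => ?_
  have hcv := G.conn_of_sureConn_of_weight_pos hω h
  simp only [G.mem_partitionEvent_three a b c, G.mem_partitionEvent_three a b v]
  have h1 : G.Conn ω a c ↔ G.Conn ω a v := ⟨fun h' => h'.trans hcv, fun h' => h'.trans hcv.symm⟩
  have h2 : G.Conn ω b c ↔ G.Conn ω b v := ⟨fun h' => h'.trans hcv, fun h' => h'.trans hcv.symm⟩
  rw [h1, h2]

/-- **Probe transfer**: C-028(c) at the probe `c` iff at any probe `v` surely joined to `c`. -/
theorem C028At_iff_of_sureConn_probe {p : E → ℝ} (hp : IsProb p) {c v : V} (h : G.SureConn p c v)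
    (a b : V) : G.C028At p a b c ↔ G.C028At p a b v := by
  have hr := G.law3_eq_of_sureConn_probe hp h a b
  unfold C028At c028Cov
  rw [hr 0, hr 1, hr 2, hr 3]

/-- Every row at the mark `a` equals the row at a mark `v` surely joined to `a`. -/
theorem law3_eq_of_sureConn_markA {p : E → ℝ} (hp : IsProb p) {a v : V} (h : G.SureConn p a v)
    (b c : V) (s : Fin 5) : G.law3 p a b c s = G.law3 p v b c s := by
  unfold law3
  refine prob_eq_of_eqOn_pos hp fun ω hω => ?_
  have hav := G.conn_of_sureConn_of_weight_pos hω h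
  simp only [G.mem_partitionEvent_three a b c, G.mem_partitionEvent_three v b c]
  have h1 : G.Conn ω a b ↔ G.Conn ω v b := ⟨fun h' => hav.symm.trans h', fun h' => hav.trans h'⟩
  have h2 : G.Conn ω a c ↔ G.Conn ω v c := ⟨fun h' => hav.symm.trans h', fun h' => hav.trans h'⟩
  rw [h1, h2]

/-- **Mark transfer**: C-028(c) with the mark `a` iff with any mark `v` surely joined to `a`. -/
theorem C028At_iff_of_sureConn_markA {p : E → ℝ} (hp : IsProb p) {a v : V} (h : G.SureConn p a v)
    (b c : V) : G.C028At p a b c ↔ G.C028At p v b c := by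
  have hr := G.law3_eq_of_sureConn_markA hp h b c
  unfold C028At c028Cov
  rw [hr 0, hr 1, hr 2, hr 3]

/-! ### A pendant sure cluster -/

/-- If every edge touching the sure cluster of `y` other than `e` is surely open or surely closed,
then with `e` forced closed the cluster of `y` is its sure cluster (positive-weight configurations). -/
theorem sureConn_of_conn_update_false_of_pendantCluster {p : E → ℝ} {e : E} (he : p e ≠ 1) {y : V}
    (hpend : ∀ e', e' ≠ e → (G.SureConn p y (G.fst e') ∨ G.SureConn p y (G.snd e')) →
      p e' = 0 ∨ p e' = 1)
    {ω : Config E} (hω : 0 < weight p ω) {v : V}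
    (h : G.Conn (Function.update ω e false) y v) : G.SureConn p y v := by
  refine Conn.induction (motive := fun v => G.SureConn p y v) (Conn.refl G _ y) ?_ h
  intro u w _ hadj hsure
  obtain ⟨e', he', hends⟩ := hadj
  have hne : e' ≠ e := by
    rintro rfl
    simp at he'
  rw [Function.update_of_ne hne] at he'
  have htouch : G.SureConn p y (G.fst e') ∨ G.SureConn p y (G.snd e') := by
    rcases hends with ⟨h1, _⟩ | ⟨_, h2⟩
    · exact Or.inl (h1 ▸ hsure)
    · exact Or.inr (h2 ▸ hsure)
  rcases hpend e' hne htouch with h0 | h1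
  · exact absurd he' (by rw [eq_false_of_weight_pos hω h0]; decide)
  · have hs : sureConfig p e' = true := by simp [sureConfig, h1]
    exact Conn.trans (show G.Conn (sureConfig p) y u from hsure) (Conn.of_openAdj ⟨e', hs, hends⟩)

/-- With `e` joining `x` and `y` and the sure cluster of `y` otherwise closed off, the connections
among vertices outside that cluster do not see `e`. -/
theorem conn_update_true_iff_of_pendantCluster {p : E → ℝ} {e : E} (he : p e ≠ 1) {y : V}
    (hy : G.fst e = y ∨ G.snd e = y)
    (hpend : ∀ e', e' ≠ e → (G.SureConn p y (G.fst e') ∨ G.SureConn p y (G.snd e')) →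
      p e' = 0 ∨ p e' = 1)
    {ω : Config E} (hω : 0 < weight p ω) {u v : V} (hu : ¬ G.SureConn p y u)
    (hv : ¬ G.SureConn p y v) :
    G.Conn (Function.update ω e true) u v ↔ G.Conn (Function.update ω e false) u v := by
  have hidem : Function.update ω e true =
      Function.update (Function.update ω e false) e true := by
    rw [Function.update_idem]
  rw [hidem, conn_update_true_iff]
  constructor
  · rintro (h | ⟨h1, h2⟩ | ⟨h1, h2⟩)
    · exact h
    · rcases hy with hy | hy
      · rw [hy] at h1
        exact absurd (G.sureConn_of_conn_update_false_of_pendantCluster he hpend hω h1.symm) hu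
      · rw [hy] at h2
        exact absurd (G.sureConn_of_conn_update_false_of_pendantCluster he hpend hω h2) hv
    · rcases hy with hy | hy
      · rw [hy] at h2
        exact absurd (G.sureConn_of_conn_update_false_of_pendantCluster he hpend hω h2) hv
      · rw [hy] at h1
        exact absurd (G.sureConn_of_conn_update_false_of_pendantCluster he hpend hω h1.symm) hu
  · intro h
    exact Or.inl h

/-- Every row of `p[e:=1]` equals the row of `p[e:=0]` at an edge into a pendant sure cluster, for
marks outside the cluster. -/
theorem law3_update_one_eq_update_zero_of_pendantCluster {p : E → ℝ} (hp : IsProb p) {e : E}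
    (he : p e ≠ 1) {y : V} (hy : G.fst e = y ∨ G.snd e = y)
    (hpend : ∀ e', e' ≠ e → (G.SureConn p y (G.fst e') ∨ G.SureConn p y (G.snd e')) →
      p e' = 0 ∨ p e' = 1)
    {a b c : V} (ha : ¬ G.SureConn p y a) (hb : ¬ G.SureConn p y b) (hc : ¬ G.SureConn p y c)
    (s : Fin 5) :
    G.law3 (Function.update p e 1) a b c s = G.law3 (Function.update p e 0) a b c s := by
  unfold law3
  rw [prob_update_one_eq_prob_lift, prob_update_zero_eq_prob_lift]
  refine prob_eq_of_eqOn_pos hp fun ω hω => ?_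
  simp only [mem_lift, G.mem_partitionEvent_three a b c,
    G.conn_update_true_iff_of_pendantCluster he hy hpend hω ha hb,
    G.conn_update_true_iff_of_pendantCluster he hy hpend hω ha hc,
    G.conn_update_true_iff_of_pendantCluster he hy hpend hω hb hc]

/-- **C-028(c) through an edge into a pendant sure cluster**: C-028(c) at `p[e:=0]` gives C-028(c)
at `p` when the marks lie outside the sure cluster of `y`. -/
theorem C028At_of_pendantCluster {p : E → ℝ} (hp : IsProb p) {e : E} (he : p e ≠ 1) {y : V}
    (hy : G.fst e = y ∨ G.snd e = y)
    (hpend : ∀ e', e' ≠ e → (G.SureConn p y (G.fst e') ∨ G.SureConn p y (G.snd e')) →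
      p e' = 0 ∨ p e' = 1)
    {a b c : V} (ha : ¬ G.SureConn p y a) (hb : ¬ G.SureConn p y b) (hc : ¬ G.SureConn p y c)
    (h0 : G.C028At (Function.update p e 0) a b c) : G.C028At p a b c := by
  have hrow := G.law3_update_one_eq_update_zero_of_pendantCluster hp he hy hpend ha hb hc
  have hA : G.pivA26 p e a b c = 0 := by
    rw [pivA26_eq, prob_update_one_eq_prob_lift, prob_update_zero_eq_prob_lift]
    rw [prob_eq_of_eqOn_pos hp (Y := lift e false (G.connEvent a b)) ?_, sub_self]
    intro ω hω
    simp only [mem_lift, mem_connEvent, G.conn_update_true_iff_of_pendantCluster he hy hpend hω ha hb]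
  have hd1 : G.c028Cov (Function.update p e 1) a b c = G.c028Cov (Function.update p e 0) a b c := by
    unfold c028Cov
    rw [hrow 0, hrow 1, hrow 2, hrow 3]
  have hd : G.c028Cov p a b c = G.c028Cov (Function.update p e 0) a b c := by
    rw [G.c028Cov_rec p e a b c, hd1, hA]
    ring
  have h2 : G.law3 p a b c 2 = G.law3 (Function.update p e 0) a b c 2 := by
    rw [G.law3_split_edge p e a b c 2, hrow 2]
    ring
  have h3 : G.law3 p a b c 3 = G.law3 (Function.update p e 0) a b c 3 := by
    rw [G.law3_split_edge p e a b c 3, hrow 3]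
    ring
  unfold C028At at h0 ⊢
  rw [hd, h2, h3]
  exact h0

end MultiGraph

end PercRepro
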